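import Summits.Ventures.CertifiedManyBodySolver.Observables.PairLROTowerChargedReading
import HarnessLib

/-!
# OP1-C, part 8: the summit-format pair-LRO ceiling LEAF from an OP1-C orbit-state node, any anchor

HONEST FRAMING: first certified bounds on pairing observables; not a superconductivity verdict; a ceiling route,
never presence; nothing in this file is a number. Crew hubbard-obs (D-0042), seat hubbard-obs-p1
(`prover-hubbard-obs-p1-g9-0`); lead RULINGS (eo) d181 / (es) d185 / (ex) d190. Zero compute; no definition; no
named fact; no `sorry`.

The registry consumers of `liminf_pairFieldLRO_le_sq_of_onePoint_chargedStationary_orbitState_bound_TT'_near`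
(PairLROTowerChargedReading): **`ObsPairLROCeilingAt_of_onePoint_charged_orbitState_bound_sq`** — a D₂-type OP1-C
claim node (orbit state over `(U_w D_γ)_{γ ∈ S}`, `b1gSign = 1` on `S ≠ ∅`; charged eom term at the grid chemical
potential `μ'`; word `X` with `X`, `Xᴴ` even and `‖N̂_{Λ'}X − XN̂_{Λ'}‖ ≤ C_q`) at the anchor `(U, n, t′)`,
`0 < n < 2`, with cap `e₀ ≤ hi ≤ u` and cell datum `μ_c ∈ [μ₋(n), μ₊(n)]`, `|μ' − μ_c| ≤ Δ`, gives
`ObsPairLROCeilingAt tp U n c'` at every `c' ≥ (c − Δ·C_q − A + (Σμ)(n/2 − ν))²`; `…_reprice` — its fast layer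
under any later cap; `M3ObsPairLROCeilingAt_of_onePoint_charged_orbitState_bound_sq` — the `(8, 7/8)` registry leaf.
CONDITIONAL on the claim node and the cell datum fed in.
References: T. Koma, H. Tasaki, J. Stat. Phys. 76 (1994) 745, Theorem 5 [KomaTasaki1994]; W. Pusz, S. L.
Woronowicz, Comm. Math. Phys. 58 (1978) 273, §1 [PuszWoronowicz1978]; D. Ruelle, *Statistical Mechanics* (1969)
§3.4 [Ruelle1969].
-/

noncomputable section

namespace Summit.Ventures.CertifiedManyBodySolver.Observables

open Matrix Complex Finset Literature.MathematicalPhysics.QuantumLattice Literature.Probability.LatticeModels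
open Literature.MathematicalPhysics.QuantumLattice.HubbardWave0 ThermodynamicLimit Filter Topology
open Literature.MathematicalPhysics.QuantumManyBody.StateRelaxation
open Summit.Ventures.CertifiedManyBodySolver.Transport
open scoped ComplexOrder ComplexConjugate BigOperators Matrix.Norms.L2Operator

/-! ### §4  The registry consumer for OP1-C nodes at ANY anchor `(U, n, t′)` -/

section Consumer

variable {tp U n : ℝ} {hi c' : ℚ} {c A κ u ν μc μ' Δ Cq : ℝ}

/-- **OP1-C orbit-state node at `(U, n, t′)` ⇒ the pair-LRO ceiling leaf at the sharp constant `(M + Δ·C_q)²`.**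
Hypotheses: `0 ≤ U`, `0 < n < 2`, cap `e₀(1,t′,U,n) ≤ hi ≤ u`, `κ ≥ 0`, a cell datum `μ_c ∈ [μ₋(n), μ₊(n)]`
with `|μ' − μ_c| ≤ Δ` (`μ'` the node's grid chemical potential), a point group `S ≠ ∅` with `b1gSign = 1`, a
window `Λ' ⊇ pairRegion {0,±e₁,±e₂} 0` fitting the tori of side `≥ L₁`, the charged eom word `X ∈ 𝔄_{Λ'}`
(`X`, `Xᴴ` even) with `‖N̂_{Λ'}X − XN̂_{Λ'}‖ ≤ C_q`, and THE NODE SHAPE OF AN OP1-C CERTIFICATE: for `L ≥ L₁` and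
unit `ζ`, `c − A + Σ_σ μ_σ(Re⟨ζ,N_σζ⟩/L² − ν) + κ(u − Re⟨ζ,H^{1,tp}_Lζ⟩/L²) + Re ω̄_ζ(K_L Γ_L X − Γ_L X K_L) ≤
Re ω̄_ζ(Γ_L(−Γ(incl)Φ₀))`, `K_L = H^{1,tp}_L − μ'N̂`. Conclusion: `ObsPairLROCeilingAt tp U n c'` at every rational
`c' ≥ (c − Δ·C_q − A + (Σ_σ μ_σ)(n/2 − ν))²`. CONDITIONAL ON THE CLAIM NODE and the cell datum; a ceiling never
speaks to presence. [cite: KomaTasaki1994, Theorem 5] [cite: PuszWoronowicz1978, §1] [cite: Ruelle1969, §3.4] -/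
theorem ObsPairLROCeilingAt_of_onePoint_charged_orbitState_bound_sq (hU : 0 ≤ U) (hn0 : 0 < n) (hn2 : n < 2)
    (μ : Fin 2 → ℝ) (hκ : 0 ≤ κ) (hE : energyDensityTT' 1 tp U n ≤ ((hi : ℚ) : ℝ)) (hhi : ((hi : ℚ) : ℝ) ≤ u)
    (hμc : μc ∈ Set.Icc (chemPotMinusTT' 1 tp U n) (chemPotPlusTT' 1 tp U n)) (hnear : |μ' - μc| ≤ Δ)
    {S : Finset (DihedralGroup 4)} (hS : S.Nonempty) (hS1 : ∀ γ ∈ S, b1gSign γ = 1)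
    {Λ' : Finset (Site 2)} (h0 : pairRegion (insert (0 : Site 2) unitSteps) 0 ⊆ Λ')
    (X : FermionOp Λ') (hXeven : X ∈ carEvenSubalgebra (Finset.univ : Finset (Orb (PolySite Λ'))))
    (hXevenH : Xᴴ ∈ carEvenSubalgebra (Finset.univ : Finset (Orb (PolySite Λ'))))
    (hXq : ‖(totalNumberOp : FermionOp Λ') * X - X * totalNumberOp‖ ≤ Cq) (L₁ : ℕ)
    (hInj : ∀ L : ℕ, L₁ ≤ L → Set.InjOn (Torus.proj (d := 2) L) ↑Λ')
    (hbound : ∀ (L : ℕ) [NeZero L] (hL : L₁ ≤ L) (ζ : Fock (Orb (FermionTorus 2 L))), star ζ ⬝ᵥ ζ = 1 →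
      c - A + ∑ σ : Fin 2, μ σ *
          ((star ζ ⬝ᵥ ((∑ y : FermionTorus 2 L, numberOp y σ) *ᵥ ζ)).re / (L : ℝ) ^ 2 - ν) +
        κ * (u - (star ζ ⬝ᵥ (hubbardTorusTT' L 1 tp U *ᵥ ζ)).re / (L : ℝ) ^ 2) +
        (orbitState (spaceGroupUnitary S) ζ
          ((hubbardTorusTT' L 1 tp U - (μ' : ℂ) • totalNumber) * fermionEmbed (PolySite.toTorusEmb L (hInj L hL)) X -
            fermionEmbed (PolySite.toTorusEmb L (hInj L hL)) X *
              (hubbardTorusTT' L 1 tp U - (μ' : ℂ) • totalNumber))).re ≤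
        (orbitState (spaceGroupUnitary S) ζ (fermionEmbed (PolySite.toTorusEmb L (hInj L hL))
          (-(fermionEmbed (PolySite.incl h0)
            (localPairAt (insert (0 : Site 2) unitSteps) dWaveFormFactor 0))))).re)
    (hc' : (c - Δ * Cq - A + (∑ σ : Fin 2, μ σ) * (n / 2 - ν)) ^ 2 ≤ ((c' : ℚ) : ℝ)) :
    ObsPairLROCeilingAt tp U n c' := by
  intro ψ hψ hψ1
  have hg : ∀ γ ∈ S, ∀ e ∈ insert (0 : Site 2) unitSteps, dWaveFormFactor (d4Vec γ e) = dWaveFormFactor e :=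
    fun γ hγ e _ => dWaveFormFactor_d4Vec_of_b1gSign_eq_one (hS1 γ hγ) e
  exact (liminf_pairFieldLRO_le_sq_of_onePoint_chargedStationary_orbitState_bound_TT'_near dWaveFormFactor 1 tp
    hU hn0 hn2 μ hκ (hE.trans hhi) hμc hnear hS hg h0 X hXeven hXevenH hXq L₁ hInj hbound ψ hψ hψ1).trans hc'

/-- **THE ONE-POINT FAST LAYER for OP1-C nodes.** The same node read under ANY certified cap `e₀ ≤ hi` gives the
leaf at every `c' ≥ (c − Δ·C_q − A + (Σμ)(n/2 − ν) + κ(u − hi))²`. [cite: KomaTasaki1994, Theorem 5] -/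
theorem ObsPairLROCeilingAt_of_onePoint_charged_orbitState_bound_sq_reprice (hU : 0 ≤ U) (hn0 : 0 < n)
    (hn2 : n < 2) (μ : Fin 2 → ℝ) (hκ : 0 ≤ κ) (hE : energyDensityTT' 1 tp U n ≤ ((hi : ℚ) : ℝ))
    (hμc : μc ∈ Set.Icc (chemPotMinusTT' 1 tp U n) (chemPotPlusTT' 1 tp U n)) (hnear : |μ' - μc| ≤ Δ)
    {S : Finset (DihedralGroup 4)} (hS : S.Nonempty) (hS1 : ∀ γ ∈ S, b1gSign γ = 1)
    {Λ' : Finset (Site 2)} (h0 : pairRegion (insert (0 : Site 2) unitSteps) 0 ⊆ Λ')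
    (X : FermionOp Λ') (hXeven : X ∈ carEvenSubalgebra (Finset.univ : Finset (Orb (PolySite Λ'))))
    (hXevenH : Xᴴ ∈ carEvenSubalgebra (Finset.univ : Finset (Orb (PolySite Λ'))))
    (hXq : ‖(totalNumberOp : FermionOp Λ') * X - X * totalNumberOp‖ ≤ Cq) (L₁ : ℕ)
    (hInj : ∀ L : ℕ, L₁ ≤ L → Set.InjOn (Torus.proj (d := 2) L) ↑Λ')
    (hbound : ∀ (L : ℕ) [NeZero L] (hL : L₁ ≤ L) (ζ : Fock (Orb (FermionTorus 2 L))), star ζ ⬝ᵥ ζ = 1 →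
      c - A + ∑ σ : Fin 2, μ σ *
          ((star ζ ⬝ᵥ ((∑ y : FermionTorus 2 L, numberOp y σ) *ᵥ ζ)).re / (L : ℝ) ^ 2 - ν) +
        κ * (u - (star ζ ⬝ᵥ (hubbardTorusTT' L 1 tp U *ᵥ ζ)).re / (L : ℝ) ^ 2) +
        (orbitState (spaceGroupUnitary S) ζ
          ((hubbardTorusTT' L 1 tp U - (μ' : ℂ) • totalNumber) * fermionEmbed (PolySite.toTorusEmb L (hInj L hL)) X -
            fermionEmbed (PolySite.toTorusEmb L (hInj L hL)) X *
              (hubbardTorusTT' L 1 tp U - (μ' : ℂ) • totalNumber))).re ≤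
        (orbitState (spaceGroupUnitary S) ζ (fermionEmbed (PolySite.toTorusEmb L (hInj L hL))
          (-(fermionEmbed (PolySite.incl h0)
            (localPairAt (insert (0 : Site 2) unitSteps) dWaveFormFactor 0))))).re)
    (hc' : (c - Δ * Cq - A + (∑ σ : Fin 2, μ σ) * (n / 2 - ν) + κ * (u - ((hi : ℚ) : ℝ))) ^ 2 ≤ ((c' : ℚ) : ℝ)) :
    ObsPairLROCeilingAt tp U n c' := by
  have hc'' : (c + κ * (u - ((hi : ℚ) : ℝ)) - Δ * Cq - A + (∑ σ : Fin 2, μ σ) * (n / 2 - ν)) ^ 2 ≤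
      ((c' : ℚ) : ℝ) := by
    have : c + κ * (u - ((hi : ℚ) : ℝ)) - Δ * Cq - A + (∑ σ : Fin 2, μ σ) * (n / 2 - ν) =
        c - Δ * Cq - A + (∑ σ : Fin 2, μ σ) * (n / 2 - ν) + κ * (u - ((hi : ℚ) : ℝ)) := by ring
    rw [this]; exact hc'
  refine ObsPairLROCeilingAt_of_onePoint_charged_orbitState_bound_sq (c := c + κ * (u - ((hi : ℚ) : ℝ)))
    (u := ((hi : ℚ) : ℝ)) hU hn0 hn2 μ hκ hE le_rfl hμc hnear hS hS1 h0 X hXeven hXevenH hXq L₁ hInj ?_ hc''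
  intro L _ hL ζ hζ
  convert hbound L hL ζ hζ using 1
  ring

/-- **Registry consumer at the M3 points `(U, n) = (8, 7/8)`, any `t′`** (the `M3ObsPairLROCeilingAt` leaf of the
hubbard-obs registry): the OP1-C node with cap node `M3EnergyUpperRow tp hi`, `hi ≤ u`, gives
`M3ObsPairLROCeilingAt tp c'` at every `c' ≥ (c − Δ·C_q − A + (Σ_σ μ_σ)(7/16 − ν))²`. CONDITIONAL ON THE CLAIM NODE.
[cite: KomaTasaki1994, Theorem 5] -/
theorem M3ObsPairLROCeilingAt_of_onePoint_charged_orbitState_bound_sq {tp : ℝ} (μ : Fin 2 → ℝ) (hκ : 0 ≤ κ)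
    (hE : M3EnergyUpperRow tp hi) (hhi : ((hi : ℚ) : ℝ) ≤ u)
    (hμc : μc ∈ Set.Icc (chemPotMinusTT' 1 tp 8 (7 / 8)) (chemPotPlusTT' 1 tp 8 (7 / 8))) (hnear : |μ' - μc| ≤ Δ)
    {S : Finset (DihedralGroup 4)} (hS : S.Nonempty) (hS1 : ∀ γ ∈ S, b1gSign γ = 1)
    {Λ' : Finset (Site 2)} (h0 : pairRegion (insert (0 : Site 2) unitSteps) 0 ⊆ Λ')
    (X : FermionOp Λ') (hXeven : X ∈ carEvenSubalgebra (Finset.univ : Finset (Orb (PolySite Λ'))))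
    (hXevenH : Xᴴ ∈ carEvenSubalgebra (Finset.univ : Finset (Orb (PolySite Λ'))))
    (hXq : ‖(totalNumberOp : FermionOp Λ') * X - X * totalNumberOp‖ ≤ Cq) (L₁ : ℕ)
    (hInj : ∀ L : ℕ, L₁ ≤ L → Set.InjOn (Torus.proj (d := 2) L) ↑Λ')
    (hbound : ∀ (L : ℕ) [NeZero L] (hL : L₁ ≤ L) (ζ : Fock (Orb (FermionTorus 2 L))), star ζ ⬝ᵥ ζ = 1 →
      c - A + ∑ σ : Fin 2, μ σ *
          ((star ζ ⬝ᵥ ((∑ y : FermionTorus 2 L, numberOp y σ) *ᵥ ζ)).re / (L : ℝ) ^ 2 - ν) +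
        κ * (u - (star ζ ⬝ᵥ (hubbardTorusTT' L 1 tp 8 *ᵥ ζ)).re / (L : ℝ) ^ 2) +
        (orbitState (spaceGroupUnitary S) ζ
          ((hubbardTorusTT' L 1 tp 8 - (μ' : ℂ) • totalNumber) * fermionEmbed (PolySite.toTorusEmb L (hInj L hL)) X -
            fermionEmbed (PolySite.toTorusEmb L (hInj L hL)) X *
              (hubbardTorusTT' L 1 tp 8 - (μ' : ℂ) • totalNumber))).re ≤
        (orbitState (spaceGroupUnitary S) ζ (fermionEmbed (PolySite.toTorusEmb L (hInj L hL))
          (-(fermionEmbed (PolySite.incl h0)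
            (localPairAt (insert (0 : Site 2) unitSteps) dWaveFormFactor 0))))).re)
    (hc' : (c - Δ * Cq - A + (∑ σ : Fin 2, μ σ) * ((7 / 8 : ℝ) / 2 - ν)) ^ 2 ≤ ((c' : ℚ) : ℝ)) :
    M3ObsPairLROCeilingAt tp c' :=
  (obsPairLROCeilingAt_m3_iff tp c').1
    (ObsPairLROCeilingAt_of_onePoint_charged_orbitState_bound_sq (by norm_num) (by norm_num) (by norm_num) μ hκ
      hE hhi hμc hnear hS hS1 h0 X hXeven hXevenH hXq L₁ hInj hbound hc')

end Consumer

end Summit.Ventures.CertifiedManyBodySolver.Observables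

end
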